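import Summits.QuantumFields.YangMills.Theorems.BalabanUVNodesN16KingModelTwoRunHolder
import Summits.QuantumFields.YangMills.Theorems.BalabanUVNodesN16KingModelTwoRunPattern

/-!
# Route «BalabanUVNodes» (K3⁶ `SpineGivenEndpointR13SepCoPR`), DAG node N16 = NE3 — THE KING-MODEL RUNG OF NE3, (3.71) LINE 4 FOR THE
# BLOCK-AVERAGED TWO-RUN DISCREPANCY: the HÖLDER QUOTIENT OF THE LATTICE DERIVATIVE `|x − y|^{−α}(∂^η_μD(x) − ∂^η_μD(y))` of
# `D = φ_k^ψ − Q_nφ_{k+n}^ψ` has King's GEOMETRIC RATE — the scalar template of N16's THIRD conjunct in its Hölder form ((1.36)₃ ∕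
# `CovRootHolder β`: the Hölder-`β` modulus of the covariant GRADIENT of the discrepancy direction), EVERY volume, PART 1

Cell `pub-ymgap`, seat `pub-ymgap-dag-n16-c` (R134 acceleration seat, strategy s1; HUMAN RULING D-0062; chair R424 venue), generation 10.
`--kind proof --supports stmt-QuantumFields-20509 --as helper` (K3⁶, dag-lead WORDS-142).  `bears_on: R4∕N16 · row «R2^ϱ, the unprinted core»`.

WHY THIS FILE.  Node N16's chain of record (`NE3EnergyWeightedCovShape.NE3EnergyRateWCov`, `N16HolderDefs.CovRootHolder β`) reads THREE
regularity currencies of the two-run discrepancy direction `Z`: its value, its first covariant differences (Lip₁ᶜ), and the HÖLDER-`β`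
MODULUS OF THE FIRST COVARIANT DIFFERENCES — the (1.36)₃ member of [Balaban1985RegularSpaces] Thm 4's output ((Lip₂′ᶜ) at `β = 1` in the
wording of record; `β < 1` in print, B8 pp. 82–83 — this seat's R-β ∕ R-β″, `LOCATED-N16-HOLDER-PIN.md`).  Generations 7–9 typed, in King's
`A = 0` scalar model, the value (file 51), the lattice derivative (52–54), the Hölder quotient of the VALUE (55–56), the three together (57)
and the decl-level `NE3Shape` (58–59); file 53 recorded «(Lip₂′ᶜ) … its template would be (3.71) line 4 for `D`, not typed here».  THIS
file types it: King's Prop. 3.8 (3.71) LINE 4 — the Hölder quotient `∂_α(x, y)` ((3.62)) of the LATTICE DERIVATIVE — for the BLOCK-AVERAGED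
two-run discrepancy, every volume (at `β = 1` King has no rate, «α + γ < 1»; at every `β = α < 1` this is the template).  Inputs BY NAME:
n18-b's `MinimizerTwoSpacingHolder.king_prop38_holder_deriv_torus` (line 4 for the ACTUAL operators, fine points over coarse points, every
unit torus) and `MinimizerHolderDecay.abs_holderS_dkernel_le_unif` (one-lattice Hölder-`s` modulus of `∂^η_μℋ_k`, via generation 8's
`N16KingModelDeriv.dkernel_neighbour_le`), n18-a's uniform constant `N18KingModelScalesPair.fprop38Const_le_unif` (at `β = α + 1`), and
this seat's lattice bookkeeping `N16KingModelBlockShift.coarseDeriv_blockMean_eq` ∕ `over_add_nsmul_cases` (file 52),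
`N16KingModelTranslate.blockMean_translate` ∕ `holdist_translate` (file 55).

MECHANISM.  `∂^η_μ(Q_nf)(x)` is the double mean, over `x′` over `x` and `j < Lⁿ`, of the fine derivatives
`∂^{η′}_μf(x′ + j·e_μ)`; the fibre of `x + v` is the fibre of `x` translated by the fine lift `Lⁿ·v`, at the SAME unit-coordinate distance
`ρ = |x − (x + v)|`.  So `ρ^{−α}(∂^η_μD_b(x) − ∂^η_μD_b(x + v))` is the double mean of
`ρ^{−α}(∂^η_μℋ_k(x) − ∂^η_μℋ_k(x + v)) − ρ^{−α}(∂^{η′}_μℋ_{k+n}(p) − ∂^{η′}_μℋ_{k+n}(p + Lⁿv))`, `p = x′ + j·e_μ`.  If `p` lies over `x`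
this is (3.71) line 4 at the pair `(x, x + v)`; if `p` lies over `x + e_μ` (one carry) it is line 4 at the pair `(x + e_μ, x + e_μ + v)`
PLUS THE MIXED PATCH `ρ^{−α}{(∂ℋ_k(x + e_μ) − ∂ℋ_k(x + v + e_μ)) − (∂ℋ_k(x) − ∂ℋ_k(x + v))}`, which the one-lattice Hölder-`s` modulus at the
neighbour distance `L^{−k}` bounds by `2H_s·(Lᵏ)^{α−s}` (`ρ ≥ L^{−k}` for `v ≠ 0`); at `s = α + γ < 1` the rate `(Lᵏ)^{−γ}` is unchanged.

WHAT THIS FILE PROVES (kernel; theorems only — 0 `def`, 0 sorry; `ℋ_k = minimiser Lᵏ M a_k (Lᵏ)² m²` King's ACTUAL operator, fibre and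
block mean spelled INLINE as in generation 7; `ρ = holdist Lᵏ M x (x + v)`; `∂^η_μg(z) = Lᵏ·(g(z + e_μ) − g(z))`):
* §1 lattice facts: `tdistT_pair_shift` ∕ `holdist_pair_shift` (the pair `(x + w, x + w + v)` is as far apart as `(x, x + v)`),
  `one_le_tdistT_of_ne` (`v ≠ 0 ⇒ |x − (x + v)| ≥ 1` in lattice units), `rpow_neg_holdist_le` (`ρ^{−α} ≤ (Lᵏ)^α`), `weight_rangeMean_sub`;
  ★ `dkernel_mixedPatch_le` — the mixed patch above `≤ 2H_{α+γ}(a)·N^{−γ}`, every unit torus, odd `N ≥ 2`.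
* §2 ★ `twoRunHolderDeriv_kernel_blockMean_le` — EVERY volume `M`, odd `L ≥ 2`, `k, n ≥ 1`, `a, m² > 0`, `0 ≤ α`, `0 < γ`, `α + γ < 1`, every
  `b, x, v, μ`: `|ρ^{−α}·(∂^η_μD_b(x) − ∂^η_μD_b(x + v))| ≤ (C₅⁗(a, L, d, γ, α) + 2H_{α+γ}(a))·(L^{−γ})^k`, `D_b = ℋ_k(·, b) − Q_nℋ_{k+n}(·, b)`,
  `C₅⁗ = fprop38RateConst a a Θ (π²∕4)^d d γ (α+1) (2d^α) (2d^α2^{1−γ}) + fprop38PosConst a (π²∕4)^d d γ (α+1) (2d^α) (6d^{α+γ})` (n18-a's uniform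
  constant of line 4), `H_s(a) = (π∕2)^d·[(π²∕4)^{d+1}·2d^sπ^{1+s} + a(π²∕4)·2d^s·C(d, s)]` (n18-b's Hölder-`s` constant);
* The datum forms — `ℓ¹` (`… ≤ (C₅⁗ + 2H_{α+γ})·(L^{−γ})^k·Σ_b|ψ(b)|`, every volume) and SUP-NORM on BAŁABAN's volumes with King's decay and
  ONE level- and volume-free constant — are the sequel `BalabanUVNodesN16KingModelTwoRunHolderDerivSup` (PART 2).

READING FOR ROW N16 (a dictionary, NOT a decl): `CovRootHolder β`'s third member «`‖∇_WZ(x) − Ad(…)∇_WZ(y)‖ ≤ B_h·|x − y|^β·ξ²·(rate)^k`»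
((1.36)₃; the extra `ξ²` = one lattice spacing per derivative in unit coordinates) ↔ `|∂^ηD(x) − ∂^ηD(x + v)| ≤ C·ρ^α·(L^{−γ})^K·Σ|ψ|`
(abelian: `Ad = id`; `α` plays `β`; `∂^η = Lᴷ·`difference, so the raw second difference `(D(x+e_μ) − D(x)) − (D(x+v+e_μ) − D(x+v))` is
`O(L^{−K}·ρ^α·θ^K)`).  With files 51–57 ALL FOUR printed lines of (3.71) now hold in kernel for the block-averaged discrepancy `D`.
NOT CARRIED: the gauge `u`, the transport `Ad(W)`, the covariant block average, Bałaban's axial constraint; `β = 1`.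

HONEST FRAMING.  A MODEL LAYER (template literature: [King1986] is printed AND proved; re-proved here in kernel from the tree's King files
BY NAME).  NOTHING of [Balaban1985RegularSpaces] ∕ [Balaban1985Variational] is proved or discharged; N16 ∕ NE3 is NOT discharged (in-edges
N05 — [B8] Thm 4 ∕ Prop 3 at the pinned all-torus members — and N07 — [B11] Thm 1 (8)+(10) — remain hypotheses of the chain of record);
COUNT UNMOVED; count-neutral; one finite torus at a time — NOT ℝ⁴, NOT infinite volume, NOT OS, NOT a mass gap, NOT Clay.

Sources: C. King, *The U(1) Higgs model. I. The continuum limit*, Commun. Math. Phys. **102** (1986) 649–677 [King1986], Prop. 3.8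
(3.71) p. 664 (line 4), (3.62) p. 663, §4 (4.19)–(4.22) p. 672, (4.26)–(4.28) p. 673, p. 674; T. Bałaban, *Regularity and decay of
lattice Green's functions*, Commun. Math. Phys. **89** (1983) 571–597 [Balaban1983RegularityDecay], Thm (1.10) p. 573.
-/

set_option autoImplicit false

noncomputable section

open Real Finset
open scoped BigOperators

namespace Summit.QuantumFields.YangMills.BalabanUVNodes.N16KingModelHolderDeriv

open Literature.MathematicalPhysics.QuantumFieldTheory.Balaban1983to89.B5Prop11Plancherel (Tor fine unitVec)
open Literature.MathematicalPhysics.QuantumFieldTheory.Balaban1983to89.B4TorusKernel.MultiPeriod (circAbs circAbs_nonneg)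
open Literature.MathematicalPhysics.QuantumFieldTheory.King1986
  (aK aK_pos aK_le lemma43Const fprop38RateConst fprop38PosConst aliasConst)
open Literature.MathematicalPhysics.QuantumFieldTheory.King1986.Torus
  (minimiser tdistT tdistT_nonneg tdistT_eq_zero_of_d circAbs_le_tdistT exists_coord_eq_tdistT holdist
    king_prop38_holder_deriv_torus)
open Summit.QuantumFields.YangMills.BalabanUVNodes.N18KingModel (rpow_neg_natPow kingTheta_pos)
open Summit.QuantumFields.YangMills.BalabanUVNodes.N18KingModelScalesPair (fprop38Const_le_unif aliasConst_nonneg_of_lt_one)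
open Summit.QuantumFields.YangMills.BalabanUVNodes.N16KingModel (mem_overFib overFib_nonempty abs_blockMean_sub_le)
open Summit.QuantumFields.YangMills.BalabanUVNodes.N16KingModelBlockShift (over_add_nsmul_cases coarseDeriv_blockMean_eq)
open Summit.QuantumFields.YangMills.BalabanUVNodes.N16KingModelTranslate
  (over_add_translate blockMean_translate blockMean_mul_sub holdist_translate circAbs_coord_add)
open Summit.QuantumFields.YangMills.BalabanUVNodes.N16KingModelDeriv (dkernel_neighbour_le abs_rangeMean_sub_le)
open Summit.QuantumFields.YangMills.BalabanUVNodes.N16KingModelPattern (eq_zero_of_tdistT_add_eq_zero)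

variable {d : ℕ}

/-! ## §1 Lattice facts: shifted pairs, `|x − (x+v)| ≥ 1` for `v ≠ 0`, the Hölder weight `ρ^{−α} ≤ N^α`, and the mixed patch -/

section Lattice

variable {K : Fin d → ℕ} [∀ μ, NeZero (K μ)]

/-- **A translated pair is as far apart**: `tdistT K (x + w) (x + w + v) = tdistT K x (x + v)` (both equal `max_ν dist(v_ν, K_νℤ)`).
[folklore] -/
theorem tdistT_pair_shift (x w v : Tor K) : tdistT K (x + w) (x + w + v) = tdistT K x (x + v) := by
  by_cases hd : d = 0
  · rw [tdistT_eq_zero_of_d _ hd, tdistT_eq_zero_of_d _ hd]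
  refine le_antisymm ?_ ?_
  · obtain ⟨μ, hμ⟩ := exists_coord_eq_tdistT K hd (x + w) (x + w + v)
    rw [hμ, circAbs_coord_add]
    have h := circAbs_le_tdistT K x (x + v) μ
    rwa [circAbs_coord_add] at h
  · obtain ⟨μ, hμ⟩ := exists_coord_eq_tdistT K hd x (x + v)
    rw [hμ, circAbs_coord_add]
    have h := circAbs_le_tdistT K (x + w) (x + w + v) μ
    rwa [circAbs_coord_add] at h

/-- **Distinct lattice points are at torus distance at least one**: `v ≠ 0 ⇒ 1 ≤ tdistT K x (x + v)` (the distance is an integer,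
and it vanishes only for `v = 0`, `N16KingModelPattern.eq_zero_of_tdistT_add_eq_zero`). [folklore] -/
theorem one_le_tdistT_of_ne (x v : Tor K) (hv : v ≠ 0) : 1 ≤ tdistT K x (x + v) := by
  by_cases hd : d = 0
  · subst hd
    exact absurd (funext fun μ => Fin.elim0 μ) hv
  obtain ⟨μ, hμ⟩ := exists_coord_eq_tdistT K hd x (x + v)
  have hK1 : 1 ≤ K μ := Nat.one_le_iff_ne_zero.mpr (NeZero.ne (K μ))
  have hc0 : 0 ≤ circAbs (K μ) (((x μ).val : ℤ) - (((x + v) μ).val : ℤ)) := circAbs_nonneg hK1 _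
  by_contra hlt
  push Not at hlt
  rw [hμ] at hlt
  have hc1 : circAbs (K μ) (((x μ).val : ℤ) - (((x + v) μ).val : ℤ)) < 1 := by exact_mod_cast hlt
  have hz : circAbs (K μ) (((x μ).val : ℤ) - (((x + v) μ).val : ℤ)) = 0 := by omega
  have h0 : tdistT K x (x + v) = 0 := by rw [hμ, hz]; simp
  exact hv (eq_zero_of_tdistT_add_eq_zero x v h0)

end Lattice

section Weight

variable {N : ℕ} [NeZero N] {M : Fin d → ℕ} [∀ μ, NeZero (M μ)]

/-- **The Hölder weight of a pair of DISTINCT points is at most `N^α`**: `v ≠ 0`, `0 ≤ α` ⇒ `(holdist N M x (x + v))^{−α} ≤ N^α`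
(`holdist = tdistT∕N ≥ N⁻¹`). [cite: King1986, (3.62) p.663, (4.26) p.673] -/
theorem rpow_neg_holdist_le (hN : 1 ≤ N) (x v : Tor (fine N M)) (hv : v ≠ 0) {α : ℝ} (hα : 0 ≤ α) :
    (holdist N M x (x + v)) ^ (-α) ≤ (N : ℝ) ^ α := by
  have hNr : (0 : ℝ) < N := by exact_mod_cast (show 0 < N by omega)
  have h1 : ((N : ℝ))⁻¹ ≤ holdist N M x (x + v) := by
    unfold holdist
    rw [le_div_iff₀ hNr, inv_mul_cancel₀ hNr.ne']
    exact one_le_tdistT_of_ne x v hv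
  calc (holdist N M x (x + v)) ^ (-α) ≤ (((N : ℝ))⁻¹) ^ (-α) :=
        Real.rpow_le_rpow_of_nonpos (inv_pos.mpr hNr) h1 (by linarith)
    _ = (N : ℝ) ^ α := by rw [Real.inv_rpow hNr.le, ← Real.rpow_neg hNr.le, neg_neg]

/-- `holdist` of a translated pair: `holdist N M (x + w) (x + w + v) = holdist N M x (x + v)`. [folklore] -/
theorem holdist_pair_shift (x w v : Tor (fine N M)) : holdist N M (x + w) (x + w + v) = holdist N M x (x + v) := by
  unfold holdist
  rw [tdistT_pair_shift]

/-- A weight times a difference of `range`-means is the `range`-mean of the weighted differences. [folklore] -/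
theorem weight_rangeMean_sub (R : ℕ) (a b : ℕ → ℝ) (w r : ℝ) :
    w * (r * ∑ j ∈ Finset.range R, a j - r * ∑ j ∈ Finset.range R, b j)
      = r * ∑ j ∈ Finset.range R, w * (a j - b j) := by
  rw [← mul_sub, ← Finset.sum_sub_distrib, Finset.mul_sum, Finset.mul_sum, Finset.mul_sum]
  refine Finset.sum_congr rfl fun j _ => ?_
  ring

/-- ★ **THE MIXED PATCH.**  For odd `N ≥ 2`, `a, m² > 0`, `0 ≤ α`, `0 < γ`, `α + γ < 1`, every unit torus, all `b, x, v, μ`, with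
`∂ℋ(z) = N·(ℋ(z + e_μ, b) − ℋ(z, b))`, `ℋ = minimiser N M a N² m²`, `ρ = holdist N M x (x + v)`:
`|ρ^{−α}·{(∂ℋ(x + e_μ) − ∂ℋ(x + v + e_μ)) − (∂ℋ(x) − ∂ℋ(x + v))}| ≤ 2·H_{α+γ}(a)·N^{−γ}` — two applications of the neighbour patch
`N16KingModelDeriv.dkernel_neighbour_le` (King's (3.71) line 4 ∕ (4.22) Hölder-`s` modulus of `∂ℋ` at distance `N⁻¹`, `s = α + γ`) and
`ρ^{−α} ≤ N^α` for `v ≠ 0` (for `v = 0` the patch vanishes). [cite: King1986, Prop. 3.8 (3.71) p.664 (line 4), (3.62) p.663, (4.19)–(4.22) p.672] -/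
theorem dkernel_mixedPatch_le (hd : 0 < d) (hNodd : Odd N) (hN2 : 2 ≤ N) {a m2 : ℝ} (ha : 0 < a) (hm : 0 < m2)
    {α γ : ℝ} (hα : 0 ≤ α) (hγ : 0 < γ) (hαγ : α + γ < 1) (b : Tor M) (x v : Tor (fine N M)) (μ : Fin d) :
    |(holdist N M x (x + v)) ^ (-α) *
        (((N : ℝ) * (minimiser N M a ((N : ℝ) ^ 2) m2 (Pi.single b 1) (x + unitVec (fine N M) μ + unitVec (fine N M) μ)
              - minimiser N M a ((N : ℝ) ^ 2) m2 (Pi.single b 1) (x + unitVec (fine N M) μ))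
            - (N : ℝ) * (minimiser N M a ((N : ℝ) ^ 2) m2 (Pi.single b 1) (x + v + unitVec (fine N M) μ + unitVec (fine N M) μ)
              - minimiser N M a ((N : ℝ) ^ 2) m2 (Pi.single b 1) (x + v + unitVec (fine N M) μ)))
          - ((N : ℝ) * (minimiser N M a ((N : ℝ) ^ 2) m2 (Pi.single b 1) (x + unitVec (fine N M) μ)
              - minimiser N M a ((N : ℝ) ^ 2) m2 (Pi.single b 1) x)
            - (N : ℝ) * (minimiser N M a ((N : ℝ) ^ 2) m2 (Pi.single b 1) (x + v + unitVec (fine N M) μ)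
              - minimiser N M a ((N : ℝ) ^ 2) m2 (Pi.single b 1) (x + v))))|
      ≤ 2 * ((π / 2) ^ d * ((π ^ 2 / 4) ^ d * (π ^ 2 / 4) * (2 * (d : ℝ) ^ (α + γ) * π ^ (α + γ + 1))
          + a * (π ^ 2 / 4) * (2 * (d : ℝ) ^ (α + γ)) * aliasConst d (α + γ))) * (N : ℝ) ^ (-γ) := by
  have hNr : (0 : ℝ) < N := by exact_mod_cast (show 0 < N by omega)
  have hs0 : 0 ≤ α + γ := by linarith
  have hAC : 0 ≤ aliasConst d (α + γ) := aliasConst_nonneg_of_lt_one hd hαγ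
  have hH0 : 0 ≤ (π / 2) ^ d * ((π ^ 2 / 4) ^ d * (π ^ 2 / 4) * (2 * (d : ℝ) ^ (α + γ) * π ^ (α + γ + 1))
      + a * (π ^ 2 / 4) * (2 * (d : ℝ) ^ (α + γ)) * aliasConst d (α + γ)) := by
    have h1 : 0 ≤ a * (π ^ 2 / 4) * (2 * (d : ℝ) ^ (α + γ)) * aliasConst d (α + γ) := mul_nonneg (by positivity) hAC
    have h2 : 0 ≤ (π ^ 2 / 4) ^ d * (π ^ 2 / 4) * (2 * (d : ℝ) ^ (α + γ) * π ^ (α + γ + 1)) := by positivity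
    exact mul_nonneg (by positivity) (add_nonneg h2 h1)
  set H : ℝ := (π / 2) ^ d * ((π ^ 2 / 4) ^ d * (π ^ 2 / 4) * (2 * (d : ℝ) ^ (α + γ) * π ^ (α + γ + 1))
    + a * (π ^ 2 / 4) * (2 * (d : ℝ) ^ (α + γ)) * aliasConst d (α + γ)) with hH
  have hrhs : 0 ≤ 2 * H * (N : ℝ) ^ (-γ) := mul_nonneg (mul_nonneg (by norm_num) hH0) (Real.rpow_nonneg hNr.le _)
  by_cases hv : v = 0
  · subst hv
    simp only [add_zero, sub_self, mul_zero, abs_zero]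
    exact hrhs
  -- the two neighbour patches (King's Hölder-`s` modulus of `∂ℋ` at distance `N⁻¹`, `s = α + γ`)
  have h1 := dkernel_neighbour_le hd hNodd hN2 M ha hm hs0 hαγ b x μ
  have h2 := dkernel_neighbour_le hd hNodd hN2 M ha hm hs0 hαγ b (x + v) μ
  have hw := rpow_neg_holdist_le (M := M) (by omega) x v hv hα
  have hw0 : 0 ≤ (holdist N M x (x + v)) ^ (-α) :=
    Real.rpow_nonneg (div_nonneg (tdistT_nonneg _ _ _) (Nat.cast_nonneg _)) _
  rw [abs_mul, abs_of_nonneg hw0]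
  have hrew : ∀ P1 P2 Q1 Q2 : ℝ, (P1 - P2) - (Q1 - Q2) = (P1 - Q1) - (P2 - Q2) := by intros; ring
  rw [hrew]
  have hsum := (abs_sub _ _).trans (add_le_add h1 h2)
  have hNN : (N : ℝ) ^ α * ((N : ℝ) ^ (-(α + γ))) = (N : ℝ) ^ (-γ) := by
    rw [← Real.rpow_add hNr]; ring_nf
  calc _ ≤ (N : ℝ) ^ α * (H * (N : ℝ) ^ (-(α + γ)) + H * (N : ℝ) ^ (-(α + γ))) :=
        mul_le_mul hw hsum (abs_nonneg _) (Real.rpow_nonneg hNr.le _)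
    _ = 2 * H * ((N : ℝ) ^ α * (N : ℝ) ^ (-(α + γ))) := by ring
    _ = 2 * H * (N : ℝ) ^ (-γ) := by rw [hNN]

end Weight

/-! ## §2 ★ EVERY VOLUME: the derivative-Hölder quotient of the two-run kernel discrepancy after block averaging -/

section EveryVolume

variable {L : ℕ} [NeZero L] (M : Fin d → ℕ) [∀ μ, NeZero (M μ)]

/-- ★ **THE HÖLDER QUOTIENT OF THE LATTICE DERIVATIVE OF THE TWO-RUN KERNEL DISCREPANCY AFTER BLOCK AVERAGING** (every volume `M`, odd
`L ≥ 2`, `k, n ≥ 1`, `a, m² > 0`, `0 ≤ α`, `0 < γ`, `α + γ < 1`): with `D_b(z) = ℋ_k(z, b) − (Q_nℋ_{k+n}(·, b))(z)`,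
`∂^η_μg(z) = Lᵏ·(g(z + e_μ) − g(z))` and `ρ = holdist Lᵏ M x (x + v)`, for every `b, x, v, μ`:
`|ρ^{−α}·(∂^η_μD_b(x) − ∂^η_μD_b(x + v))| ≤ (C₅⁗(a, L, d, γ, α) + 2H_{α+γ}(a))·(L^{−γ})^k`.  Proof: the module docstring's mechanism —
`coarseDeriv_blockMean_eq` at `x` and at `x + v`, `blockMean_translate`, the dichotomy `over_add_nsmul_cases`, King's (3.71) line 4
`king_prop38_holder_deriv_torus` at the pair `(x, x + v)` or at `(x + e_μ, x + e_μ + v)` with `holdist_translate` ∕ `holdist_pair_shift`,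
the mixed patch `dkernel_mixedPatch_le`, and `fprop38Const_le_unif` (at `β = α + 1`), `a_k ≤ a`, `(Lᵏ)^{−γ} = (L^{−γ})^k`.
[cite: King1986, Prop. 3.8 (3.71) p.664 (line 4), (3.62) p.663, (4.26)–(4.28) p.673, p.674] -/
theorem twoRunHolderDeriv_kernel_blockMean_le (hd : 0 < d) (hLodd : Odd L) (hL : 2 ≤ L) {k n : ℕ} (hk : 1 ≤ k) (hn : 1 ≤ n)
    {a m2 : ℝ} (ha : 0 < a) (hm : 0 < m2) {α γ : ℝ} (hα : 0 ≤ α) (hγ : 0 < γ) (hαγ : α + γ < 1) (b : Tor M)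
    (x v : Tor (fine (L ^ k) M)) (μ : Fin d) :
    |(holdist (L ^ k) M x (x + v)) ^ (-α) *
        (((L ^ k : ℕ) : ℝ) *
          ((minimiser (L ^ k) M (aK a L k) (((L ^ k : ℕ) : ℝ) ^ 2) m2 (Pi.single b 1) (x + unitVec (fine (L ^ k) M) μ)
              - (((Finset.univ.filter fun y : Tor (fine (L ^ n * L ^ k) M) =>
                    ∀ ν, ((x + unitVec (fine (L ^ k) M) μ) ν).val = (y ν).val / L ^ n).card : ℝ))⁻¹ *
                ∑ y ∈ (Finset.univ.filter fun y : Tor (fine (L ^ n * L ^ k) M) =>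
                    ∀ ν, ((x + unitVec (fine (L ^ k) M) μ) ν).val = (y ν).val / L ^ n),
                  minimiser (L ^ n * L ^ k) M (aK a L (k + n)) (((L ^ n * L ^ k : ℕ) : ℝ) ^ 2) m2 (Pi.single b 1) y)
            - (minimiser (L ^ k) M (aK a L k) (((L ^ k : ℕ) : ℝ) ^ 2) m2 (Pi.single b 1) x
              - (((Finset.univ.filter fun x' : Tor (fine (L ^ n * L ^ k) M) =>
                    ∀ ν, (x ν).val = (x' ν).val / L ^ n).card : ℝ))⁻¹ *
                ∑ x' ∈ (Finset.univ.filter fun x' : Tor (fine (L ^ n * L ^ k) M) => ∀ ν, (x ν).val = (x' ν).val / L ^ n),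
                  minimiser (L ^ n * L ^ k) M (aK a L (k + n)) (((L ^ n * L ^ k : ℕ) : ℝ) ^ 2) m2 (Pi.single b 1) x'))
        - ((L ^ k : ℕ) : ℝ) *
          ((minimiser (L ^ k) M (aK a L k) (((L ^ k : ℕ) : ℝ) ^ 2) m2 (Pi.single b 1) (x + v + unitVec (fine (L ^ k) M) μ)
              - (((Finset.univ.filter fun y : Tor (fine (L ^ n * L ^ k) M) =>
                    ∀ ν, ((x + v + unitVec (fine (L ^ k) M) μ) ν).val = (y ν).val / L ^ n).card : ℝ))⁻¹ *
                ∑ y ∈ (Finset.univ.filter fun y : Tor (fine (L ^ n * L ^ k) M) =>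
                    ∀ ν, ((x + v + unitVec (fine (L ^ k) M) μ) ν).val = (y ν).val / L ^ n),
                  minimiser (L ^ n * L ^ k) M (aK a L (k + n)) (((L ^ n * L ^ k : ℕ) : ℝ) ^ 2) m2 (Pi.single b 1) y)
            - (minimiser (L ^ k) M (aK a L k) (((L ^ k : ℕ) : ℝ) ^ 2) m2 (Pi.single b 1) (x + v)
              - (((Finset.univ.filter fun y : Tor (fine (L ^ n * L ^ k) M) =>
                    ∀ ν, ((x + v) ν).val = (y ν).val / L ^ n).card : ℝ))⁻¹ *
                ∑ y ∈ (Finset.univ.filter fun y : Tor (fine (L ^ n * L ^ k) M) => ∀ ν, ((x + v) ν).val = (y ν).val / L ^ n),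
                  minimiser (L ^ n * L ^ k) M (aK a L (k + n)) (((L ^ n * L ^ k : ℕ) : ℝ) ^ 2) m2 (Pi.single b 1) y)))|
      ≤ ((fprop38RateConst a a (a * (2 * ((a * (1 - ((L : ℝ) ^ 2)⁻¹))⁻¹ + π ^ 2 / 48 + 1 / 3))) ((π ^ 2 / 4) ^ d) d γ (α + 1)
              (2 * (d : ℝ) ^ α) (2 * (d : ℝ) ^ α * 2 ^ (1 - γ))
            + fprop38PosConst a ((π ^ 2 / 4) ^ d) d γ (α + 1) (2 * (d : ℝ) ^ α) (6 * (d : ℝ) ^ (α + γ)))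
          + 2 * ((π / 2) ^ d * ((π ^ 2 / 4) ^ d * (π ^ 2 / 4) * (2 * (d : ℝ) ^ (α + γ) * π ^ (α + γ + 1))
            + a * (π ^ 2 / 4) * (2 * (d : ℝ) ^ (α + γ)) * aliasConst d (α + γ)))) * ((L : ℝ) ^ (-γ)) ^ k := by
  -- elementary facts
  have hL0 : 0 < L := by omega
  have hLr : (1 : ℝ) < L := by exact_mod_cast (lt_of_lt_of_le one_lt_two hL)
  have hLn : 0 < L ^ n := pow_pos hL0 n
  have hNodd : Odd (L ^ k) := hLodd.pow
  have hN2 : 2 ≤ L ^ k := by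
    calc 2 ≤ L := hL
      _ = L ^ 1 := (pow_one L).symm
      _ ≤ L ^ k := Nat.pow_le_pow_right hL0 hk
  have haK : 0 < aK a L k := aK_pos ha hLr hk
  have haKle : aK a L k ≤ a := aK_le ha hLr hk
  have hAC : 0 ≤ aliasConst d (α + γ) := aliasConst_nonneg_of_lt_one hd hαγ
  have hAC' : 0 ≤ aliasConst d (α + 1 + γ - 1) := by rw [show α + 1 + γ - 1 = α + γ by ring]; exact hAC
  have hr : 0 ≤ ((L ^ k : ℕ) : ℝ) ^ (-γ) := Real.rpow_nonneg (Nat.cast_nonneg _) _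
  -- names for the constants
  set Ck : ℝ := fprop38RateConst a a (lemma43Const a L k n) ((π ^ 2 / 4) ^ d) d γ (α + 1) (2 * (d : ℝ) ^ α)
      (2 * (d : ℝ) ^ α * 2 ^ (1 - γ))
    + fprop38PosConst a ((π ^ 2 / 4) ^ d) d γ (α + 1) (2 * (d : ℝ) ^ α) (6 * (d : ℝ) ^ (α + γ)) with hCk
  set Cu : ℝ := fprop38RateConst a a (a * (2 * ((a * (1 - ((L : ℝ) ^ 2)⁻¹))⁻¹ + π ^ 2 / 48 + 1 / 3))) ((π ^ 2 / 4) ^ d) d γ (α + 1)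
      (2 * (d : ℝ) ^ α) (2 * (d : ℝ) ^ α * 2 ^ (1 - γ))
    + fprop38PosConst a ((π ^ 2 / 4) ^ d) d γ (α + 1) (2 * (d : ℝ) ^ α) (6 * (d : ℝ) ^ (α + γ)) with hCu
  have hHk0 : 0 ≤ (π / 2) ^ d * ((π ^ 2 / 4) ^ d * (π ^ 2 / 4) * (2 * (d : ℝ) ^ (α + γ) * π ^ (α + γ + 1))
      + aK a L k * (π ^ 2 / 4) * (2 * (d : ℝ) ^ (α + γ)) * aliasConst d (α + γ)) := by
    have h1 : 0 ≤ aK a L k * (π ^ 2 / 4) * (2 * (d : ℝ) ^ (α + γ)) * aliasConst d (α + γ) :=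
      mul_nonneg (mul_nonneg (mul_nonneg haK.le (by positivity)) (by positivity)) hAC
    have h2 : 0 ≤ (π ^ 2 / 4) ^ d * (π ^ 2 / 4) * (2 * (d : ℝ) ^ (α + γ) * π ^ (α + γ + 1)) := by positivity
    exact mul_nonneg (by positivity) (add_nonneg h2 h1)
  have hHle : (π / 2) ^ d * ((π ^ 2 / 4) ^ d * (π ^ 2 / 4) * (2 * (d : ℝ) ^ (α + γ) * π ^ (α + γ + 1))
      + aK a L k * (π ^ 2 / 4) * (2 * (d : ℝ) ^ (α + γ)) * aliasConst d (α + γ))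
      ≤ (π / 2) ^ d * ((π ^ 2 / 4) ^ d * (π ^ 2 / 4) * (2 * (d : ℝ) ^ (α + γ) * π ^ (α + γ + 1))
      + a * (π ^ 2 / 4) * (2 * (d : ℝ) ^ (α + γ)) * aliasConst d (α + γ)) := by
    have h1 : aK a L k * (π ^ 2 / 4) * (2 * (d : ℝ) ^ (α + γ)) * aliasConst d (α + γ)
        ≤ a * (π ^ 2 / 4) * (2 * (d : ℝ) ^ (α + γ)) * aliasConst d (α + γ) :=
      mul_le_mul_of_nonneg_right (mul_le_mul_of_nonneg_right (mul_le_mul_of_nonneg_right haKle (by positivity))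
        (by positivity)) hAC
    exact mul_le_mul_of_nonneg_left (add_le_add le_rfl h1) (by positivity)
  set Hk : ℝ := (π / 2) ^ d * ((π ^ 2 / 4) ^ d * (π ^ 2 / 4) * (2 * (d : ℝ) ^ (α + γ) * π ^ (α + γ + 1))
    + aK a L k * (π ^ 2 / 4) * (2 * (d : ℝ) ^ (α + γ)) * aliasConst d (α + γ)) with hHk
  set Hu : ℝ := (π / 2) ^ d * ((π ^ 2 / 4) ^ d * (π ^ 2 / 4) * (2 * (d : ℝ) ^ (α + γ) * π ^ (α + γ + 1))
    + a * (π ^ 2 / 4) * (2 * (d : ℝ) ^ (α + γ)) * aliasConst d (α + γ)) with hHu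
  have hCle : Ck ≤ Cu := fprop38Const_le_unif (d := d) ha hL hk hn (V := (π ^ 2 / 4) ^ d) (γ := γ) (β := α + 1)
    (cE := 2 * (d : ℝ) ^ α) (rE := 2 * (d : ℝ) ^ α * 2 ^ (1 - γ)) (sE := 6 * (d : ℝ) ^ (α + γ)) (by positivity) (by positivity) hAC'
  -- split the weight over the `ℋ_k`-part and the `Q_nℋ_{k+n}`-part, commute derivative and block mean, translate the fibre of `x + v`
  have hrew : ∀ w a1 q1 a0 q0 b1 p1 b0 p0 : ℝ,
      w * (((L ^ k : ℕ) : ℝ) * ((a1 - q1) - (a0 - q0)) - ((L ^ k : ℕ) : ℝ) * ((b1 - p1) - (b0 - p0)))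
        = w * (((L ^ k : ℕ) : ℝ) * (a1 - a0) - ((L ^ k : ℕ) : ℝ) * (b1 - b0))
          - w * (((L ^ k : ℕ) : ℝ) * (q1 - q0) - ((L ^ k : ℕ) : ℝ) * (p1 - p0)) := by intros; ring
  rw [hrew, coarseDeriv_blockMean_eq M x μ
      (minimiser (L ^ n * L ^ k) M (aK a L (k + n)) (((L ^ n * L ^ k : ℕ) : ℝ) ^ 2) m2 (Pi.single b 1)),
    coarseDeriv_blockMean_eq M (x + v) μ
      (minimiser (L ^ n * L ^ k) M (aK a L (k + n)) (((L ^ n * L ^ k : ℕ) : ℝ) ^ 2) m2 (Pi.single b 1))]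
  have hT := blockMean_translate x v (fun x' : Tor (fine (L ^ n * L ^ k) M) =>
    (((L ^ n : ℕ) : ℝ))⁻¹ * ∑ j ∈ Finset.range (L ^ n), ((L ^ n * L ^ k : ℕ) : ℝ) *
      (minimiser (L ^ n * L ^ k) M (aK a L (k + n)) (((L ^ n * L ^ k : ℕ) : ℝ) ^ 2) m2 (Pi.single b 1) (x' + j • unitVec (fine (L ^ n * L ^ k) M) μ + unitVec (fine (L ^ n * L ^ k) M) μ)
        - minimiser (L ^ n * L ^ k) M (aK a L (k + n)) (((L ^ n * L ^ k : ℕ) : ℝ) ^ 2) m2 (Pi.single b 1) (x' + j • unitVec (fine (L ^ n * L ^ k) M) μ)))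
  beta_reduce at hT
  rw [hT]
  -- names for the kernels, the Hölder weight and the coarse derivative-Hölder term
  set F : Tor (fine (L ^ n * L ^ k) M) → ℝ :=
    minimiser (L ^ n * L ^ k) M (aK a L (k + n)) (((L ^ n * L ^ k : ℕ) : ℝ) ^ 2) m2 (Pi.single b 1) with hF
  set A : Tor (fine (L ^ k) M) → ℝ := minimiser (L ^ k) M (aK a L k) (((L ^ k : ℕ) : ℝ) ^ 2) m2 (Pi.single b 1) with hA
  set ρ : ℝ := holdist (L ^ k) M x (x + v) with hρ
  set t : ℝ := ρ ^ (-α) * (((L ^ k : ℕ) : ℝ) * (A (x + unitVec (fine (L ^ k) M) μ) - A x) - ((L ^ k : ℕ) : ℝ) * (A (x + v + unitVec (fine (L ^ k) M) μ) - A (x + v))) with ht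
  -- the pointwise bound at every fine point `x' + j·e_μ` read by the derivative of the block mean, paired with its `Lⁿv`-translate
  have hpt : ∀ x' : Tor (fine (L ^ n * L ^ k) M), (∀ ν, (x ν).val = (x' ν).val / L ^ n) → ∀ j ∈ Finset.range (L ^ n),
      |ρ ^ (-α) * (((L ^ n * L ^ k : ℕ) : ℝ) * (F (x' + j • unitVec (fine (L ^ n * L ^ k) M) μ + unitVec (fine (L ^ n * L ^ k) M) μ) - F (x' + j • unitVec (fine (L ^ n * L ^ k) M) μ))
          - ((L ^ n * L ^ k : ℕ) : ℝ) * (F (x' + (fun ν => (((v ν).val * L ^ n : ℕ) : ZMod (fine (L ^ n * L ^ k) M ν))) + j • unitVec (fine (L ^ n * L ^ k) M) μ + unitVec (fine (L ^ n * L ^ k) M) μ)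
            - F (x' + (fun ν => (((v ν).val * L ^ n : ℕ) : ZMod (fine (L ^ n * L ^ k) M ν))) + j • unitVec (fine (L ^ n * L ^ k) M) μ))) - t|
        ≤ Ck * ((L ^ k : ℕ) : ℝ) ^ (-γ) + 2 * Hk * ((L ^ k : ℕ) : ℝ) ^ (-γ) := by
    intro x' hx' j hj
    have hjlt : j < L ^ n := Finset.mem_range.1 hj
    have h2 : 0 ≤ 2 * Hk * ((L ^ k : ℕ) : ℝ) ^ (-γ) := mul_nonneg (mul_nonneg (by norm_num) hHk0) hr
    have hcomm : x' + (fun ν => (((v ν).val * L ^ n : ℕ) : ZMod (fine (L ^ n * L ^ k) M ν))) + j • unitVec (fine (L ^ n * L ^ k) M) μ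
        = x' + j • unitVec (fine (L ^ n * L ^ k) M) μ + (fun ν => (((v ν).val * L ^ n : ℕ) : ZMod (fine (L ^ n * L ^ k) M ν))) := add_right_comm _ _ _
    rw [hcomm]
    rcases over_add_nsmul_cases x x' hx' μ hjlt with h0 | h1
    · -- the fine point lies over `x`: line 4 at the pair `(x, x + v)`
      have hover := over_add_translate x (x' + j • unitVec (fine (L ^ n * L ^ k) M) μ) h0 v
      have h := king_prop38_holder_deriv_torus hd hLodd hL hk hn M ha hm hα hγ hαγ b x (x + v) (x' + j • unitVec (fine (L ^ n * L ^ k) M) μ)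
        (x' + j • unitVec (fine (L ^ n * L ^ k) M) μ + (fun ν => (((v ν).val * L ^ n : ℕ) : ZMod (fine (L ^ n * L ^ k) M ν)))) h0 hover μ
      rw [holdist_translate x v (x' + j • unitVec (fine (L ^ n * L ^ k) M) μ)] at h
      exact h.trans (le_add_of_nonneg_right h2)
    · -- one carry: line 4 at the pair `(x + e_μ, x + e_μ + v)` plus the mixed patch
      have hover := over_add_translate (x + unitVec (fine (L ^ k) M) μ) (x' + j • unitVec (fine (L ^ n * L ^ k) M) μ) h1 v
      have h := king_prop38_holder_deriv_torus hd hLodd hL hk hn M ha hm hα hγ hαγ b (x + unitVec (fine (L ^ k) M) μ) (x + unitVec (fine (L ^ k) M) μ + v)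
        (x' + j • unitVec (fine (L ^ n * L ^ k) M) μ) (x' + j • unitVec (fine (L ^ n * L ^ k) M) μ + (fun ν => (((v ν).val * L ^ n : ℕ) : ZMod (fine (L ^ n * L ^ k) M ν)))) h1 hover μ
      rw [holdist_translate (x + unitVec (fine (L ^ k) M) μ) v (x' + j • unitVec (fine (L ^ n * L ^ k) M) μ), holdist_pair_shift x (unitVec (fine (L ^ k) M) μ) v,
        add_right_comm x (unitVec (fine (L ^ k) M) μ) v] at h
      have hP := dkernel_mixedPatch_le hd hNodd hN2 (M := M) haK hm hα hγ hαγ b x v μ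
      have hrew2 : ∀ w P1 P2 Q1 Q2 : ℝ, w * (P1 - P2) - w * (Q1 - Q2) = w * ((P1 - P2) - (Q1 - Q2)) := by intros; ring
      have hP' : |ρ ^ (-α) * (((L ^ k : ℕ) : ℝ) * (A (x + unitVec (fine (L ^ k) M) μ + unitVec (fine (L ^ k) M) μ) - A (x + unitVec (fine (L ^ k) M) μ))
            - ((L ^ k : ℕ) : ℝ) * (A (x + v + unitVec (fine (L ^ k) M) μ + unitVec (fine (L ^ k) M) μ) - A (x + v + unitVec (fine (L ^ k) M) μ))) - t|
          ≤ 2 * Hk * ((L ^ k : ℕ) : ℝ) ^ (-γ) := by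
        rw [ht, hrew2]
        exact hP
      exact (abs_sub_le _ _ _).trans (add_le_add h hP')
  -- average the pointwise bound over `j < Lⁿ` and over the fibre of `x`
  have hmean := abs_blockMean_sub_le (overFib_nonempty (by omega) k n M x)
    (f := fun x' : Tor (fine (L ^ n * L ^ k) M) => ρ ^ (-α) *
      ((((L ^ n : ℕ) : ℝ))⁻¹ * ∑ j ∈ Finset.range (L ^ n), ((L ^ n * L ^ k : ℕ) : ℝ) * (F (x' + j • unitVec (fine (L ^ n * L ^ k) M) μ + unitVec (fine (L ^ n * L ^ k) M) μ) - F (x' + j • unitVec (fine (L ^ n * L ^ k) M) μ))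
        - (((L ^ n : ℕ) : ℝ))⁻¹ * ∑ j ∈ Finset.range (L ^ n),
          ((L ^ n * L ^ k : ℕ) : ℝ) * (F (x' + (fun ν => (((v ν).val * L ^ n : ℕ) : ZMod (fine (L ^ n * L ^ k) M ν))) + j • unitVec (fine (L ^ n * L ^ k) M) μ + unitVec (fine (L ^ n * L ^ k) M) μ)
            - F (x' + (fun ν => (((v ν).val * L ^ n : ℕ) : ZMod (fine (L ^ n * L ^ k) M ν))) + j • unitVec (fine (L ^ n * L ^ k) M) μ))))
    (t := t) (C := Ck * ((L ^ k : ℕ) : ℝ) ^ (-γ) + 2 * Hk * ((L ^ k : ℕ) : ℝ) ^ (-γ))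
    (fun x' hx' => by
      have hx := mem_overFib.1 hx'
      rw [weight_rangeMean_sub]
      exact abs_rangeMean_sub_le hLn (fun j hj => hpt x' hx j hj))
  rw [blockMean_mul_sub, abs_sub_comm] at hmean
  refine hmean.trans ?_
  rw [← add_mul, rpow_neg_natPow]
  exact mul_le_mul_of_nonneg_right (add_le_add hCle (mul_le_mul_of_nonneg_left hHle (by norm_num)))
    (pow_nonneg (kingTheta_pos (by omega) γ).le k)

end EveryVolume

end Summit.QuantumFields.YangMills.BalabanUVNodes.N16KingModelHolderDeriv

end
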